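import Summits.ValiantsHypothesis.ValiantsHypothesis.Theorems.KPlusLogSqLawTropicalCycleMonotone

/-!
# Route «KPlusLogSqLaw», crux `TropicalB` (stmt-ValiantsHypothesis-19771) — THE PARITY LAW:
# a dominant pair whose later term is class-smaller off ONE column has a HAMILTONIAN quotient; on a board of EVEN size three
# such pairs close a sign contradiction — «even size + lexicographic exponents ⇒ never counting-tight (K ≥ 5)»

HONEST FRAMING.  Helper toward the registered stubs `stub_tropThin` / `stub_tropFat` of `Cruxes/TropicalB/Lines/birth.lean` (crux
`Summit.ValiantsHypothesis.ValiantsHypothesis.Theses.KPlusLogSqLaw.TropicalB`, item stmt-ValiantsHypothesis-19771, route KPlusLogSqLaw;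
cell `pub-symmetroid`, seat val-sym-trop-p4 g10, 2026-08-27; `--supports … --as helper`).  A STRUCTURE LAW about unique optima
(`IsDominant`) of an ARBITRARY dominance design (any format, any valuations, any signs) plus one infinite family of FORBIDDEN HISTOGRAM
TRIPLES; nothing here bounds `TropicalB` in its window, and nothing bears on `WeakLifting`, DoorA26 / DoorA34, `MatrixDescartes`
(stmt-ValiantsHypothesis-18050) or VP ≠ VNP.

THE LAW.
* `hamiltonian_quotient` — let `(σ₁, λ₁)` be the unique optimum at `θ₁` and `(σ₂, λ₂)` at `θ₂ > θ₁`, and suppose the LATER term is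
  class-smaller off one column `s`: `d (λ₂ b) < d (λ₁ b)` for every `b ≠ s`.  Then (`m ≥ 2`) the quotient `σ₁⁻¹σ₂` moves EVERY column and
  all columns lie in ONE cycle: it is an `m`-cycle (`isCycle_quotient`, `support_quotient`), so its sign is `−(−1)^m`
  (`sign_quotient`), i.e. `−1` when `m` is even (`sign_quotient_of_even`).  Proof: the cyclewise exchange law
  (`sum_d_lt_of_isDominant_invariant`, conjb-2 g4 / val-sym-trop-p4) on an invariant column set avoiding `s` on which the terms differ
  would give `Σ d(λ₁) < Σ d(λ₂)` there, against the pointwise hypothesis; so no fixed column `≠ s`, no cycle avoiding `s`, and `s`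
  itself moves.
* `parity_law` — **THE PARITY LAW.**  `m` even, `m ≥ 2`; classes `c₀, c₁, c₂` with `d c₀ < d c₁ < d c₂`.  No design has three terms
  `A = (α, all columns c₂)`, `B = (β, c₁ except one column carrying a class c₃ with d c₀ < d c₃)`, `C = (γ, c₀ except one column, any
  class there)` dominant at slopes `θ_A < θ_B < θ_C`: the three quotients `α⁻¹β`, `α⁻¹γ`, `β⁻¹γ` are Hamiltonian, hence odd, while
  `α⁻¹γ = (α⁻¹β)(β⁻¹γ)` is even.  `parity_law_chain`: the same along any family of dominant terms indexed by increasing slopes.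
READING (located, not claimed beyond the theorems).  With super-increasing («lexicographic») exponents the histograms
`m·{c₂}`, `(m−1)·{c₁} + {c₃}`, `(m−1)·{c₀} + {c₄}` of five classes `c₀ < ⋯ < c₄` have slopes in this order, and every term with one
of these histograms has the shape of `A`, `B`, `C`; so on a board of EVEN size with `K ≥ 5` classes a dominant chain misses at least one
of the three histograms — the lexicographic `(m, K)` cells with `m` even, `K ≥ 5` are NEVER counting-tight (first instance `(4,5)`:
`T ≤ 68 < 69 = C(8,4) − 1`; the `m = 2` row `T(2,K) = 4K − 7 < C(K+1,2) − 1`, p443198, is consistent).  Genesis: an exhaustive pairwise-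
exchange CSP over the 70 histograms of `(4,5)` with `d = (0,1,5,25,125)` (seat folder exp/f2csp.c, 12 794 nodes) is UNSAT with the
3-slot core `{2222}, {1113}, {0004}` = this law; at ODD `m` an `m`-cycle is even and the mechanism is silent (`(3,5)`'s lexicographic
deficiency is the different 5-histogram pattern of …TropicalBForbiddenPatterns).  [this cell; the exchange inequality is folklore,
`Equiv.Perm.IsCycle.sign` is Mathlib]
-/

set_option linter.dupNamespace false
set_option autoImplicit false

namespace Summit.ValiantsHypothesis.ValiantsHypothesis.Theorems.KPlusLogSqLaw

namespace ParityLaw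

open Summit.ValiantsHypothesis.ValiantsHypothesis.Theorems.MatrixDescartes.Negative
open Finset

variable {m K : ℕ}

/-- **HAMILTONIAN QUOTIENT.**  `(σ₁, λ₁)` dominant at `θ₁`, `(σ₂, λ₂)` dominant at `θ₂ > θ₁`, the later term class-smaller off one
column `s` (`d (λ₂ b) < d (λ₁ b)` for `b ≠ s`), `m ≥ 2`.  Then `σ₁⁻¹σ₂` moves every column and every column is in the cycle of `s`.
[this cell] -/
theorem hamiltonian_quotient (d : Fin K → ℕ) (v ε : Fin m → Fin m → Fin K → ℤ) {θ₁ θ₂ : ℤ} (hθ : θ₁ < θ₂)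
    {σ₁ σ₂ : Equiv.Perm (Fin m)} {l₁ l₂ : Fin m → Fin K}
    (h₁ : IsDominant d v ε θ₁ (σ₁, l₁)) (h₂ : IsDominant d v ε θ₂ (σ₂, l₂)) (s : Fin m)
    (hlt : ∀ b, b ≠ s → d (l₂ b) < d (l₁ b)) (hm : 2 ≤ m) :
    (∀ b, (σ₁⁻¹ * σ₂) b ≠ b) ∧ ∀ b, (σ₁⁻¹ * σ₂).SameCycle s b := by
  classical
  set q := σ₁⁻¹ * σ₂ with hq
  -- no invariant column set avoiding `s` on which the terms differ… in fact none avoiding `s` at all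
  have noT : ∀ T : Finset (Fin m), (∀ b, q b ∈ T ↔ b ∈ T) → s ∉ T → T.Nonempty → False := by
    intro T hT hs hne
    obtain ⟨b₀, hb₀⟩ := hne
    have hb₀s : b₀ ≠ s := fun h => hs (h ▸ hb₀)
    have hdiff : ∃ b ∈ T, σ₁ b ≠ σ₂ b ∨ l₁ b ≠ l₂ b :=
      ⟨b₀, hb₀, Or.inr fun h => absurd (hlt b₀ hb₀s) (by rw [h]; exact lt_irrefl _)⟩
    have hlaw := sum_d_lt_of_isDominant_invariant d v ε hθ h₁ h₂ T hT hdiff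
    have hrev : ∑ b ∈ T, (d (l₂ b) : ℤ) < ∑ b ∈ T, (d (l₁ b) : ℤ) :=
      Finset.sum_lt_sum (fun b hb => by exact_mod_cast (hlt b fun h => hs (h ▸ hb)).le)
        ⟨b₀, hb₀, by exact_mod_cast hlt b₀ hb₀s⟩
    exact absurd hlaw (not_lt.mpr hrev.le)
  -- (a) no column other than `s` is fixed
  have hmoved : ∀ b, b ≠ s → q b ≠ b := by
    intro b hbs hfix
    refine noT {b} (fun y => ?_) (fun h => hbs (Finset.mem_singleton.mp h).symm) ⟨b, Finset.mem_singleton_self b⟩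
    rw [Finset.mem_singleton, Finset.mem_singleton]
    constructor
    · intro h; exact q.injective (h.trans hfix.symm)
    · intro h; rw [h, hfix]
  -- (b) every column is in the cycle of `s`
  have hsame : ∀ b, q.SameCycle s b := by
    intro b
    by_contra hns
    refine noT (univ.filter fun y => q.SameCycle b y) (fun y => ?_) ?_ ⟨b, ?_⟩
    · simp only [Finset.mem_filter, Finset.mem_univ, true_and]
      exact Equiv.Perm.sameCycle_apply_right
    · simp only [Finset.mem_filter, Finset.mem_univ, true_and]
      exact fun h => hns h.symm
    · simp only [Finset.mem_filter, Finset.mem_univ, true_and]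
      exact Equiv.Perm.SameCycle.refl _ _
  -- (c) `s` itself moves
  have hsmoved : q s ≠ s := by
    intro hfix
    obtain ⟨b, hb⟩ : ∃ b : Fin m, b ≠ s := by
      have : Nontrivial (Fin m) := Fin.nontrivial_iff_two_le.mpr hm
      exact exists_ne s
    obtain ⟨i, hi⟩ := hsame b
    have : (q ^ i) s = s := Equiv.Perm.zpow_apply_eq_self_of_apply_eq_self hfix i
    exact hb (hi.symm.trans this)
  exact ⟨fun b => if h : b = s then h ▸ hsmoved else hmoved b h, hsame⟩

/-- the quotient of `hamiltonian_quotient` is a cycle … [this cell] -/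
theorem isCycle_quotient (d : Fin K → ℕ) (v ε : Fin m → Fin m → Fin K → ℤ) {θ₁ θ₂ : ℤ} (hθ : θ₁ < θ₂)
    {σ₁ σ₂ : Equiv.Perm (Fin m)} {l₁ l₂ : Fin m → Fin K}
    (h₁ : IsDominant d v ε θ₁ (σ₁, l₁)) (h₂ : IsDominant d v ε θ₂ (σ₂, l₂)) (s : Fin m)
    (hlt : ∀ b, b ≠ s → d (l₂ b) < d (l₁ b)) (hm : 2 ≤ m) : (σ₁⁻¹ * σ₂).IsCycle := by
  obtain ⟨hmv, hsame⟩ := hamiltonian_quotient d v ε hθ h₁ h₂ s hlt hm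
  exact ⟨s, hmv s, fun y _ => hsame y⟩

/-- … with full support. [this cell] -/
theorem support_quotient (d : Fin K → ℕ) (v ε : Fin m → Fin m → Fin K → ℤ) {θ₁ θ₂ : ℤ} (hθ : θ₁ < θ₂)
    {σ₁ σ₂ : Equiv.Perm (Fin m)} {l₁ l₂ : Fin m → Fin K}
    (h₁ : IsDominant d v ε θ₁ (σ₁, l₁)) (h₂ : IsDominant d v ε θ₂ (σ₂, l₂)) (s : Fin m)
    (hlt : ∀ b, b ≠ s → d (l₂ b) < d (l₁ b)) (hm : 2 ≤ m) : (σ₁⁻¹ * σ₂).support = univ := by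
  classical
  obtain ⟨hmv, -⟩ := hamiltonian_quotient d v ε hθ h₁ h₂ s hlt hm
  ext b
  simp only [Equiv.Perm.mem_support, Finset.mem_univ, iff_true]
  exact hmv b

/-- **sign of a Hamiltonian quotient**: `−(−1)^m`. [this cell; `Equiv.Perm.IsCycle.sign`] -/
theorem sign_quotient (d : Fin K → ℕ) (v ε : Fin m → Fin m → Fin K → ℤ) {θ₁ θ₂ : ℤ} (hθ : θ₁ < θ₂)
    {σ₁ σ₂ : Equiv.Perm (Fin m)} {l₁ l₂ : Fin m → Fin K}
    (h₁ : IsDominant d v ε θ₁ (σ₁, l₁)) (h₂ : IsDominant d v ε θ₂ (σ₂, l₂)) (s : Fin m)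
    (hlt : ∀ b, b ≠ s → d (l₂ b) < d (l₁ b)) (hm : 2 ≤ m) :
    Equiv.Perm.sign (σ₁⁻¹ * σ₂) = -(-1) ^ m := by
  classical
  have h := (isCycle_quotient d v ε hθ h₁ h₂ s hlt hm).sign
  rw [support_quotient d v ε hθ h₁ h₂ s hlt hm, Finset.card_univ, Fintype.card_fin] at h
  exact h

/-- on a board of EVEN size the Hamiltonian quotient is an ODD permutation. [this cell] -/
theorem sign_quotient_of_even (heven : Even m) (d : Fin K → ℕ) (v ε : Fin m → Fin m → Fin K → ℤ) {θ₁ θ₂ : ℤ}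
    (hθ : θ₁ < θ₂) {σ₁ σ₂ : Equiv.Perm (Fin m)} {l₁ l₂ : Fin m → Fin K}
    (h₁ : IsDominant d v ε θ₁ (σ₁, l₁)) (h₂ : IsDominant d v ε θ₂ (σ₂, l₂)) (s : Fin m)
    (hlt : ∀ b, b ≠ s → d (l₂ b) < d (l₁ b)) (hm : 2 ≤ m) :
    Equiv.Perm.sign (σ₁⁻¹ * σ₂) = -1 := by
  rw [sign_quotient d v ε hθ h₁ h₂ s hlt hm, neg_inj]
  exact heven.neg_one_pow

/-- **THE PARITY LAW.**  `m` even, `m ≥ 2`; `d c₀ < d c₁ < d c₂`.  There is no design with three dominant terms at slopes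
`θ_A < θ_B < θ_C` of the shapes `A = (α, all c₂)`, `B = (β, c₁ off one column bs, class of exponent > d c₀ at bs)`,
`C = (γ, c₀ off one column cs, anything at cs)`.  (Three Hamiltonian, hence odd, quotients with `α⁻¹γ = (α⁻¹β)(β⁻¹γ)`.) [this cell] -/
theorem parity_law (heven : Even m) (hm : 2 ≤ m) (d : Fin K → ℕ) (v ε : Fin m → Fin m → Fin K → ℤ)
    (c₀ c₁ c₂ : Fin K) (h01 : d c₀ < d c₁) (h12 : d c₁ < d c₂)
    {α β γ : Equiv.Perm (Fin m)} {lA lB lC : Fin m → Fin K} (bs cs : Fin m)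
    (hlA : ∀ b, lA b = c₂) (hlB : ∀ b, b ≠ bs → lB b = c₁) (hbs : d c₀ < d (lB bs)) (hlC : ∀ b, b ≠ cs → lC b = c₀)
    {θA θB θC : ℤ} (hAB : θA < θB) (hBC : θB < θC)
    (hA : IsDominant d v ε θA (α, lA)) (hB : IsDominant d v ε θB (β, lB)) (hC : IsDominant d v ε θC (γ, lC)) : False := by
  -- the three quotients are odd
  have sAB : Equiv.Perm.sign (α⁻¹ * β) = -1 :=
    sign_quotient_of_even heven d v ε hAB hA hB bs (fun b hb => by rw [hlB b hb, hlA b]; exact h12) hm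
  have sAC : Equiv.Perm.sign (α⁻¹ * γ) = -1 :=
    sign_quotient_of_even heven d v ε (hAB.trans hBC) hA hC cs
      (fun b hb => by rw [hlC b hb, hlA b]; exact h01.trans h12) hm
  have sBC : Equiv.Perm.sign (β⁻¹ * γ) = -1 :=
    sign_quotient_of_even heven d v ε hBC hB hC cs (fun b hb => by
      rw [hlC b hb]
      by_cases h : b = bs
      · rw [h]; exact hbs
      · rw [hlB b h]; exact h01) hm
  -- but `α⁻¹γ = (α⁻¹β)(β⁻¹γ)` is even
  have hprod : α⁻¹ * γ = (α⁻¹ * β) * (β⁻¹ * γ) := by group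
  rw [hprod, Equiv.Perm.sign_mul, sAB, sBC] at sAC
  exact absurd sAC (by decide)

/-- **the parity law along a dominant family** (the crux's chains): for `m` even, `m ≥ 2`, `d c₀ < d c₁ < d c₂`, no family of dominant
terms at strictly increasing slopes carries, at indices `i < j < k`, terms of the shapes `A`, `B`, `C` of `parity_law`. [this cell] -/
theorem parity_law_chain (heven : Even m) (hm : 2 ≤ m) (d : Fin K → ℕ) (v ε : Fin m → Fin m → Fin K → ℤ)
    (c₀ c₁ c₂ : Fin K) (h01 : d c₀ < d c₁) (h12 : d c₁ < d c₂)
    {n : ℕ} (θ : Fin (n + 1) → ℤ) (p : Fin (n + 1) → Equiv.Perm (Fin m) × (Fin m → Fin K))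
    (hθ : StrictMono θ) (hdom : ∀ t, IsDominant d v ε (θ t) (p t))
    {i j k : Fin (n + 1)} (hij : i < j) (hjk : j < k) (bs cs : Fin m)
    (hlA : ∀ b, (p i).2 b = c₂) (hlB : ∀ b, b ≠ bs → (p j).2 b = c₁) (hbs : d c₀ < d ((p j).2 bs))
    (hlC : ∀ b, b ≠ cs → (p k).2 b = c₀) : False :=
  parity_law heven hm d v ε c₀ c₁ c₂ h01 h12 bs cs hlA hlB hbs hlC (hθ hij) (hθ hjk) (hdom i) (hdom j) (hdom k)

end ParityLaw

end Summit.ValiantsHypothesis.ValiantsHypothesis.Theorems.KPlusLogSqLaw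

/-! ## Appended: the parity law with a general first term -/

namespace Summit.ValiantsHypothesis.ValiantsHypothesis.Theorems.KPlusLogSqLaw.ParityLaw

open Summit.ValiantsHypothesis.ValiantsHypothesis.Theorems.MatrixDescartes.Negative

variable {m K : ℕ}

/-- **THE PARITY LAW, general first term.**  As `parity_law`, but `A` may be ANY term all of whose classes have exponent above
`d c₁` (not necessarily constant): `m` even, `m ≥ 2`, `d c₀ < d c₁`; no design has dominant `A ≺ B ≺ C` with `d c₁ < d (lA b)` for
all `b`, `B = c₁` off one column `bs` (exponent `> d c₀` at `bs`), `C = c₀` off one column `cs`.  With super-increasing exponents this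
forbids, beyond `parity_law`'s triple, every triple of histograms «all classes ≥ c₂» ≺ `(m−1)·{c₁} + {x}` ≺ `(m−1)·{c₀} + {y}` whose
slopes are so ordered (more such triples exist from `K = 6` on). [this cell] -/
theorem parity_law_above (heven : Even m) (hm : 2 ≤ m) (d : Fin K → ℕ) (v ε : Fin m → Fin m → Fin K → ℤ)
    (c₀ c₁ : Fin K) (h01 : d c₀ < d c₁)
    {α β γ : Equiv.Perm (Fin m)} {lA lB lC : Fin m → Fin K} (bs cs : Fin m)
    (hlA : ∀ b, d c₁ < d (lA b)) (hlB : ∀ b, b ≠ bs → lB b = c₁) (hbs : d c₀ < d (lB bs)) (hlC : ∀ b, b ≠ cs → lC b = c₀)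
    {θA θB θC : ℤ} (hAB : θA < θB) (hBC : θB < θC)
    (hA : IsDominant d v ε θA (α, lA)) (hB : IsDominant d v ε θB (β, lB)) (hC : IsDominant d v ε θC (γ, lC)) : False := by
  have sAB : Equiv.Perm.sign (α⁻¹ * β) = -1 :=
    sign_quotient_of_even heven d v ε hAB hA hB bs (fun b hb => by rw [hlB b hb]; exact hlA b) hm
  have sAC : Equiv.Perm.sign (α⁻¹ * γ) = -1 :=
    sign_quotient_of_even heven d v ε (hAB.trans hBC) hA hC cs (fun b hb => by rw [hlC b hb]; exact h01.trans (hlA b)) hm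
  have sBC : Equiv.Perm.sign (β⁻¹ * γ) = -1 :=
    sign_quotient_of_even heven d v ε hBC hB hC cs (fun b hb => by
      rw [hlC b hb]
      by_cases h : b = bs
      · rw [h]; exact hbs
      · rw [hlB b h]; exact h01) hm
  have hprod : α⁻¹ * γ = (α⁻¹ * β) * (β⁻¹ * γ) := by group
  rw [hprod, Equiv.Perm.sign_mul, sAB, sBC] at sAC
  exact absurd sAC (by decide)

/-- chain form of `parity_law_above`. [this cell] -/
theorem parity_law_above_chain (heven : Even m) (hm : 2 ≤ m) (d : Fin K → ℕ) (v ε : Fin m → Fin m → Fin K → ℤ)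
    (c₀ c₁ : Fin K) (h01 : d c₀ < d c₁)
    {n : ℕ} (θ : Fin (n + 1) → ℤ) (p : Fin (n + 1) → Equiv.Perm (Fin m) × (Fin m → Fin K))
    (hθ : StrictMono θ) (hdom : ∀ t, IsDominant d v ε (θ t) (p t))
    {i j k : Fin (n + 1)} (hij : i < j) (hjk : j < k) (bs cs : Fin m)
    (hlA : ∀ b, d c₁ < d ((p i).2 b)) (hlB : ∀ b, b ≠ bs → (p j).2 b = c₁) (hbs : d c₀ < d ((p j).2 bs))
    (hlC : ∀ b, b ≠ cs → (p k).2 b = c₀) : False :=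
  parity_law_above heven hm d v ε c₀ c₁ h01 bs cs hlA hlB hbs hlC (hθ hij) (hθ hjk) (hdom i) (hdom j) (hdom k)

end Summit.ValiantsHypothesis.ValiantsHypothesis.Theorems.KPlusLogSqLaw.ParityLaw

/-! ## Appended: the fully pointwise form -/

namespace Summit.ValiantsHypothesis.ValiantsHypothesis.Theorems.KPlusLogSqLaw.ParityLaw

open Summit.ValiantsHypothesis.ValiantsHypothesis.Theorems.MatrixDescartes.Negative

variable {m K : ℕ}

/-- **THE PARITY LAW, pointwise form** (subsumes `parity_law` and `parity_law_above`).  `m` even, `m ≥ 2`.  No design has three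
dominant terms `A ≺ B ≺ C` (slopes `θ_A < θ_B < θ_C`) such that `B` is class-smaller than `A` off one column, `C` is class-smaller than
`B` off one column, and `C` is class-smaller than `A` off one column (`d (lB b) < d (lA b)` for `b ≠ s₁`, `d (lC b) < d (lB b)` for
`b ≠ s₂`, `d (lC b) < d (lA b)` for `b ≠ s₃`): the three quotients are Hamiltonian, hence odd, and `α⁻¹γ = (α⁻¹β)(β⁻¹γ)`.  Located: at
`(4,6)` with lexicographic exponents ALL thirteen minimal unsatisfiable slot triples of the pairwise law are instances (seat folder
exp/f2cores.c), and there is no unsatisfiable pair. [this cell] -/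
theorem parity_law_pointwise (heven : Even m) (hm : 2 ≤ m) (d : Fin K → ℕ) (v ε : Fin m → Fin m → Fin K → ℤ)
    {α β γ : Equiv.Perm (Fin m)} {lA lB lC : Fin m → Fin K} (s₁ s₂ s₃ : Fin m)
    (hAB : ∀ b, b ≠ s₁ → d (lB b) < d (lA b)) (hBC : ∀ b, b ≠ s₂ → d (lC b) < d (lB b))
    (hAC : ∀ b, b ≠ s₃ → d (lC b) < d (lA b))
    {θA θB θC : ℤ} (hθAB : θA < θB) (hθBC : θB < θC)
    (hA : IsDominant d v ε θA (α, lA)) (hB : IsDominant d v ε θB (β, lB)) (hC : IsDominant d v ε θC (γ, lC)) : False := by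
  have sAB : Equiv.Perm.sign (α⁻¹ * β) = -1 := sign_quotient_of_even heven d v ε hθAB hA hB s₁ hAB hm
  have sAC : Equiv.Perm.sign (α⁻¹ * γ) = -1 := sign_quotient_of_even heven d v ε (hθAB.trans hθBC) hA hC s₃ hAC hm
  have sBC : Equiv.Perm.sign (β⁻¹ * γ) = -1 := sign_quotient_of_even heven d v ε hθBC hB hC s₂ hBC hm
  have hprod : α⁻¹ * γ = (α⁻¹ * β) * (β⁻¹ * γ) := by group
  rw [hprod, Equiv.Perm.sign_mul, sAB, sBC] at sAC
  exact absurd sAC (by decide)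

/-- chain form of `parity_law_pointwise`. [this cell] -/
theorem parity_law_pointwise_chain (heven : Even m) (hm : 2 ≤ m) (d : Fin K → ℕ) (v ε : Fin m → Fin m → Fin K → ℤ)
    {n : ℕ} (θ : Fin (n + 1) → ℤ) (p : Fin (n + 1) → Equiv.Perm (Fin m) × (Fin m → Fin K))
    (hθ : StrictMono θ) (hdom : ∀ t, IsDominant d v ε (θ t) (p t))
    {i j k : Fin (n + 1)} (hij : i < j) (hjk : j < k) (s₁ s₂ s₃ : Fin m)
    (hAB : ∀ b, b ≠ s₁ → d ((p j).2 b) < d ((p i).2 b)) (hBC : ∀ b, b ≠ s₂ → d ((p k).2 b) < d ((p j).2 b))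
    (hAC : ∀ b, b ≠ s₃ → d ((p k).2 b) < d ((p i).2 b)) : False :=
  parity_law_pointwise heven hm d v ε s₁ s₂ s₃ hAB hBC hAC (hθ hij) (hθ hjk) (hdom i) (hdom j) (hdom k)

end Summit.ValiantsHypothesis.ValiantsHypothesis.Theorems.KPlusLogSqLaw.ParityLaw
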